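import Summits.Langlands.Langlands.Theses.HolomorphicShadow
import Summits.Langlands.Langlands.Theorems.IrreducibilityBySelfDualityIrreducibleOffSectorArtinType
import HarnessLib

/-!
# Route `HolomorphicShadow` — crux `SectorComplement` (stmt-Langlands-14623), line `pieces`, stub B⁺
# (`stub_evenArtinPlaneOfMaass`): the complex-to-`ℓ`-adic transport on the even Artin plane (piece P₃)

Stub B⁺ of `Cruxes/SectorComplement/Lines/pieces.lean` (the even Artin plane of Fontaine–Mazur–
Langlands from the even-Maass slice `H`) factors, in the strategist's card
(`Lines/birth_HolomorphicShadow_EvenArtinPlaneOfMaass.lean`), through four pieces P₁–P₄; P₃ is the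
passage from even strong Artin over `ℚ` in L-algebraic, COMPLEX form (every irreducible even
`σ : Γ_ℚ → GL₂(ℂ)` has an L-algebraic cuspidal `P` with `satakePolynomial`-matching at almost all
places) to the `ℓ`-ADIC plane statement (every irreducible even Artin-type `ρ : Γ_ℚ →ₜ* GL₂(ℚ̄_ℓ)`,
open kernel, has an L-algebraic cuspidal `π` with `SatakeFrobCompatibleAt ι π ρ` a.e.).

This file proves P₃ — in every rank and over every number field — by the `ℓ`-adic/complex
transport of the CONTRAGREDIENT, mirror image of the landed
`IrreducibleOffSector.exists_lAdicDualTransport`: `σ := ι ∘ (ρ^∨)`, i.e. `σ(g) = ι(((ρ g)⁻¹)ᵀ)`,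
is continuous (its kernel is the open kernel of `ρ`), irreducible (duality + semilinear transport),
has `det σ(c) = ι(det ρ(c))⁻¹` (so even iff `ρ` is), and satisfies EXACTLY the matrix relation
`ρ(g) = ι⁻¹(((σ g)⁻¹)ᵀ)` under which the landed `hasFrobCharpolyAt_of_lAdicDualTransport` turns
`charpoly σ(Frob_v) = ∏ (X - a)` into `charpoly ρ(Frob_v) = arithFrobPolyOfSatake ι q_v 1 α`.

* `exists_complexDualTransport` — the transport `σ` with its matrix relation, kernel dictionary,
  determinant formula and irreducibility;
* `lAdicPlane_of_complexPlane` — P₃ in every rank `n` over every `K`;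
* `complexToLAdicTransport_evenArtinPlane` — P₃ verbatim as typed in the strategist's card
  (`stub_complexToLAdicTransport`, `n = 2`, `K = ℚ`, evenness `det = 1` at complex conjugations).

HONEST STATUS: unconditional and sorry-free, but it is ONE of four pieces of ONE of five stubs of an
open-problem crux (`SectorComplement` = Langlands minus the even-Maass slice); P₂ (classical Maass
eigenform → cuspidal automorphic representation, with L-algebraicity) has no carrier in the tree.
Helper of stmt-Langlands-14623; proves reciprocity for nothing.

References: [BuzzardGeeLMS2014] Conj. 3.2.2, Rem. 3.2.5; [DeligneSerreASENS1974] §8;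
[SerreAbelianLadic1968] Ch. I §1.1.
-/

noncomputable section

set_option linter.dupNamespace false -- project-wide option; `Summit.Langlands.Langlands` is the mandated namespace

open scoped NumberField Classical Polynomial Matrix
open Filter IsDedekindDomain Polynomial
open Literature.NumberTheory.Automorphic Literature.NumberTheory.GaloisRepresentations
open Summit.Langlands
open Summit.Langlands.Langlands.Theorems.IrreducibleOffSector

namespace Summit.Langlands.Langlands.Theorems.HolomorphicShadow

variable {K : Type} [Field K] [NumberField K] {n : ℕ} {ℓ : ℕ} [Fact ℓ.Prime]

omit [NumberField K] in
/-- **The complex transport of the contragredient of an Artin-type `ℓ`-adic representation.**  For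
`ρ : Γ_K →ₜ* GL_n(ℚ̄_ℓ)` with OPEN kernel and `ι : ℚ̄_ℓ ≃+* ℂ` there is a continuous
`σ : Γ_K →ₜ* GL_n(ℂ)` with `ρ(g) = ι⁻¹(((σ g)⁻¹)ᵀ)` entrywise (namely `σ(g) = ι(((ρ g)⁻¹)ᵀ)`;
continuity: its kernel is the open kernel of `ρ`), with `ρ g = 1 ↔ σ g = 1`,
`det σ(g) = ι((det ρ(g))⁻¹)`, and irreducible if `ρ` is (`FramedRep.isIrreducible_dual`,
`isIrreducible_of_semilinear_transport`). [cite: SerreAbelianLadic1968, Ch. I §1.1 Remark]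
[cite: BuzzardGeeLMS2014, Rem. 3.2.5] -/
theorem exists_complexDualTransport (ρ : FramedGaloisRep K (PadicAlgCl ℓ) n) (ι : PadicAlgCl ℓ ≃+* ℂ)
    (hker : IsOpen (ρ.toMonoidHom.ker : Set (Field.absoluteGaloisGroup K))) :
    ∃ σ : FramedGaloisRep K ℂ n,
      (∀ g : Field.absoluteGaloisGroup K,
        ((ρ g : GL (Fin n) (PadicAlgCl ℓ)) : Matrix (Fin n) (Fin n) (PadicAlgCl ℓ)) =
          ((((σ g)⁻¹ : GL (Fin n) ℂ) : Matrix (Fin n) (Fin n) ℂ)ᵀ).map (ι.symm : ℂ → PadicAlgCl ℓ)) ∧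
      (∀ g : Field.absoluteGaloisGroup K, ρ g = 1 ↔ σ g = 1) ∧
      (∀ g : Field.absoluteGaloisGroup K,
        ((Matrix.GeneralLinearGroup.det (σ g) : ℂˣ) : ℂ) =
          ι (((Matrix.GeneralLinearGroup.det (ρ g))⁻¹ : (PadicAlgCl ℓ)ˣ) : PadicAlgCl ℓ)) ∧
      (ρ.toGaloisRep.IsIrreducible → σ.toGaloisRep.IsIrreducible) := by
  set τ : FramedGaloisRep K (PadicAlgCl ℓ) n := FramedRep.dual ρ with hτ
  set φ : Field.absoluteGaloisGroup K →* GL (Fin n) ℂ :=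
    (Matrix.GeneralLinearGroup.map ((ι : PadicAlgCl ℓ ≃+* ℂ) : PadicAlgCl ℓ →+* ℂ)).comp
      τ.toMonoidHom with hφ
  have hφapply : ∀ g, ((φ g : GL (Fin n) ℂ) : Matrix (Fin n) (Fin n) ℂ) =
      ((((ρ g)⁻¹ : GL (Fin n) (PadicAlgCl ℓ)) : Matrix (Fin n) (Fin n) (PadicAlgCl ℓ))ᵀ).map
        ((ι : PadicAlgCl ℓ ≃+* ℂ) : PadicAlgCl ℓ →+* ℂ) := fun g => rfl
  -- the kernel dictionary
  have hτρ : ∀ g, τ g = 1 ↔ ρ g = 1 := by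
    intro g
    change glTransposeInv (Fin n) (PadicAlgCl ℓ) (ρ g) = 1 ↔ ρ g = 1
    constructor
    · intro h
      have h' := congrArg (fun u : GL (Fin n) (PadicAlgCl ℓ) =>
        ((u : GL (Fin n) (PadicAlgCl ℓ)) : Matrix (Fin n) (Fin n) (PadicAlgCl ℓ))ᵀ) h
      simp only [coe_glTransposeInv_apply, Matrix.transpose_transpose, Units.val_one,
        Matrix.transpose_one] at h'
      have h'' : (ρ g)⁻¹ = 1 := Units.val_eq_one.mp h'
      exact inv_eq_one.mp h''
    · intro h
      rw [h, map_one]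
  have hφτ : ∀ g, φ g = 1 ↔ τ g = 1 := by
    intro g
    rw [← Units.val_eq_one, ← Units.val_eq_one (a := τ g)]
    change (((τ g : GL (Fin n) (PadicAlgCl ℓ)) : Matrix (Fin n) (Fin n) (PadicAlgCl ℓ)).map
      ((ι : PadicAlgCl ℓ ≃+* ℂ) : PadicAlgCl ℓ →+* ℂ)) = 1 ↔ _
    constructor
    · intro h
      have h1 : (((τ g : GL (Fin n) (PadicAlgCl ℓ)) : Matrix (Fin n) (Fin n) (PadicAlgCl ℓ)).map
          ((ι : PadicAlgCl ℓ ≃+* ℂ) : PadicAlgCl ℓ →+* ℂ)) =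
          (1 : Matrix (Fin n) (Fin n) (PadicAlgCl ℓ)).map ((ι : PadicAlgCl ℓ ≃+* ℂ) : PadicAlgCl ℓ →+* ℂ) := by
        rw [h, Matrix.map_one _ (map_zero _) (map_one _)]
      exact Matrix.map_injective (ι : PadicAlgCl ℓ ≃+* ℂ).injective h1
    · intro h
      rw [h, Matrix.map_one _ (map_zero _) (map_one _)]
  -- continuity from the open kernel of `ρ`
  have hkerφ : IsOpen (φ.ker : Set (Field.absoluteGaloisGroup K)) := by
    refine Subgroup.isOpen_mono ?_ hker
    intro g hg
    rw [MonoidHom.mem_ker] at hg ⊢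
    exact (hφτ g).mpr ((hτρ g).mpr hg)
  let σ : FramedGaloisRep K ℂ n := ⟨φ, MonoidHom.continuous_of_isOpen_ker φ hkerφ⟩
  have hσ : ∀ g, σ g = φ g := fun g => rfl
  refine ⟨σ, fun g => ?_, fun g => ((hτρ g).symm.trans (hφτ g).symm), fun g => ?_, fun hirr => ?_⟩
  · -- the matrix relation `ρ(g) = ι⁻¹(((σ g)⁻¹)ᵀ)`
    have hinv : ((σ g)⁻¹ : GL (Fin n) ℂ) = φ g⁻¹ := by rw [hσ, map_inv]
    have hcomp : ((ι.symm : ℂ → PadicAlgCl ℓ) ∘ (((ι : PadicAlgCl ℓ ≃+* ℂ) : PadicAlgCl ℓ →+* ℂ) :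
        PadicAlgCl ℓ → ℂ)) = id := by
      funext x; simp
    rw [hinv, hφapply, map_inv, inv_inv, ← Matrix.transpose_map, Matrix.transpose_transpose,
      Matrix.map_map, hcomp, Matrix.map_id]
  · -- the determinant
    rw [Matrix.GeneralLinearGroup.val_det_apply, hσ, hφapply, ← RingHom.mapMatrix_apply,
      ← RingHom.map_det, Matrix.det_transpose, ← Matrix.GeneralLinearGroup.val_det_apply, map_inv]
    rfl
  · -- irreducibility: `ρ` irreducible ⇒ `τ = ρ^∨` irreducible ⇒ its transport irreducible
    have hτirr : τ.IsIrreducible := FramedRep.isIrreducible_dual ρ hirr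
    change σ.toRepresentation.IsIrreducible
    refine isIrreducible_of_semilinear_transport (ι : PadicAlgCl ℓ ≃+* ℂ) (ρA := τ.toRepresentation)
      (fun g x => ?_) hτirr
    funext i
    rw [FramedRep.toRepresentation_apply_apply, FramedRep.toRepresentation_apply_apply, hσ]
    change ((((τ g : GL (Fin n) (PadicAlgCl ℓ)) : Matrix (Fin n) (Fin n) (PadicAlgCl ℓ)).map
        ((ι : PadicAlgCl ℓ ≃+* ℂ) : PadicAlgCl ℓ →+* ℂ)) *ᵥ
          (((ι : PadicAlgCl ℓ ≃+* ℂ) : PadicAlgCl ℓ →+* ℂ) ∘ x)) i =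
      ((ι : PadicAlgCl ℓ ≃+* ℂ) : PadicAlgCl ℓ →+* ℂ) ((((τ g : GL (Fin n) (PadicAlgCl ℓ)) :
        Matrix (Fin n) (Fin n) (PadicAlgCl ℓ)) *ᵥ x) i)
    rw [RingHom.map_mulVec]

/-- **P₃ in every rank over every number field: the `ℓ`-adic plane from the complex plane.**  If
every irreducible `σ : Γ_K →ₜ* GL_n(ℂ)` satisfying a condition `C` on the determinants at a set of
group elements has an L-algebraic cuspidal `P` on `GL_n(𝔸_K)` with `charpoly σ(Frob_v) = ∏_{a ∈ α_v}
(X - a)` for the Satake parameter `α_v` of `P` at almost every `v`, then every irreducible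
`ρ : Γ_K →ₜ* GL_n(ℚ̄_ℓ)` with open kernel whose determinants satisfy the `ι`-transported condition has
an L-algebraic cuspidal `π` with `SatakeFrobCompatibleAt ι π ρ` at almost every place.  Here the
condition is evenness, `det = 1` at the complex conjugations (transported by
`det σ(c) = ι(det ρ(c))⁻¹`). [cite: BuzzardGeeLMS2014, Conj. 3.2.2 and Rem. 3.2.5] -/
theorem lAdicPlane_of_complexPlane (hcpt : isCompact_glFiniteIntegralLevel n K)
    (hSA : ∀ σ : FramedGaloisRep K ℂ n, σ.toGaloisRep.IsIrreducible →
      (∀ (φ : K →+* ℝ) (c : Field.absoluteGaloisGroup K), IsComplexConjugation φ c →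
        Matrix.GeneralLinearGroup.det (σ c) = 1) →
      ∃ (hcpt' : isCompact_glFiniteIntegralLevel n K) (P : CuspidalAutomorphicRepData n K hcpt'),
        P.1.IsLAlgebraic ∧ (∀ᶠ v : HeightOneSpectrum (𝓞 K) in Filter.cofinite, ∃ α : Multiset ℂ,
          AutomorphicRepData.HasSatakeParamAt P.1 v α ∧ FramedGaloisRep.IsUnramifiedAt v σ ∧
          FramedGaloisRep.HasFrobCharpolyAt v (satakePolynomial α) σ))
    (ι : PadicAlgCl ℓ ≃+* ℂ) (ρ : FramedGaloisRep K (PadicAlgCl ℓ) n)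
    (hirr : ρ.toGaloisRep.IsIrreducible)
    (hker : IsOpen (ρ.toMonoidHom.ker : Set (Field.absoluteGaloisGroup K)))
    (hev : ∀ (φ : K →+* ℝ) (c : Field.absoluteGaloisGroup K), IsComplexConjugation φ c →
      Matrix.GeneralLinearGroup.det (ρ c) = 1) :
    ∃ π : CuspidalAutomorphicRepData n K hcpt, π.1.IsLAlgebraic ∧
      ∀ᶠ v : HeightOneSpectrum (𝓞 K) in cofinite, SatakeFrobCompatibleAt ι π.1 ρ v := by
  obtain ⟨σ, hσρ, hkerd, hdet, hirrσ⟩ := exists_complexDualTransport ρ ι hker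
  have hevσ : ∀ (φ : K →+* ℝ) (c : Field.absoluteGaloisGroup K), IsComplexConjugation φ c →
      Matrix.GeneralLinearGroup.det (σ c) = 1 := by
    intro φ c hc
    rw [← Units.val_eq_one, hdet c, hev φ c hc, inv_one, Units.val_one, map_one]
  obtain ⟨hcpt', P, hL, hP⟩ := hSA σ (hirrσ hirr) hevσ
  refine ⟨P, hL, ?_⟩
  filter_upwards [hP] with v hv
  obtain ⟨α, hα, hur, hcp⟩ := hv
  exact ⟨α, hα, fun 𝔓 h𝔓 g hg => (hkerd g).mpr (hur 𝔓 h𝔓 g hg),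
    hasFrobCharpolyAt_of_lAdicDualTransport hσρ hcp⟩

/-- **Piece P₃ of stub B⁺, verbatim as typed in the strategist's card** (`stub_complexToLAdicTransport`
of `Lines/birth_HolomorphicShadow_EvenArtinPlaneOfMaass.lean`): even strong Artin over `ℚ` in
L-algebraic complex form ⇒ the `ℓ`-adic even Artin plane over `ℚ`.  Unconditional; `n = 2`, `K = ℚ`
instance of `lAdicPlane_of_complexPlane`. [cite: BuzzardGeeLMS2014, Conj. 3.2.2 and Rem. 3.2.5]
[cite: DeligneSerreASENS1974, §8] -/
theorem complexToLAdicTransport_evenArtinPlane :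
    (∀ σ : Literature.NumberTheory.GaloisRepresentations.FramedGaloisRep ℚ ℂ 2, σ.toGaloisRep.IsIrreducible → (∀ (φ : ℚ →+* ℝ) (c : Field.absoluteGaloisGroup ℚ), Literature.NumberTheory.GaloisRepresentations.IsComplexConjugation φ c → Matrix.GeneralLinearGroup.det (σ c) = 1) → ∃ (hcpt : Literature.NumberTheory.Automorphic.isCompact_glFiniteIntegralLevel 2 ℚ) (P : Literature.NumberTheory.Automorphic.CuspidalAutomorphicRepData 2 ℚ hcpt), P.1.IsLAlgebraic ∧ (∀ᶠ v : IsDedekindDomain.HeightOneSpectrum (NumberField.RingOfIntegers ℚ) in Filter.cofinite, ∃ α : Multiset ℂ, Literature.NumberTheory.Automorphic.AutomorphicRepData.HasSatakeParamAt P.1 v α ∧ Literature.NumberTheory.GaloisRepresentations.FramedGaloisRep.IsUnramifiedAt v σ ∧ Literature.NumberTheory.GaloisRepresentations.FramedGaloisRep.HasFrobCharpolyAt v (Literature.NumberTheory.Automorphic.satakePolynomial α) σ)) →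
    ∀ (hcpt : Literature.NumberTheory.Automorphic.isCompact_glFiniteIntegralLevel 2 ℚ) (ℓ : ℕ) [Fact ℓ.Prime] (ι : PadicAlgCl ℓ ≃+* ℂ) (ρ : Literature.NumberTheory.GaloisRepresentations.FramedGaloisRep ℚ (PadicAlgCl ℓ) 2), ρ.toGaloisRep.IsIrreducible → IsOpen (ρ.toMonoidHom.ker : Set (Field.absoluteGaloisGroup ℚ)) → (∀ (φ : ℚ →+* ℝ) (c : Field.absoluteGaloisGroup ℚ), Literature.NumberTheory.GaloisRepresentations.IsComplexConjugation φ c → Matrix.GeneralLinearGroup.det (ρ c) = 1) → ∃ π : Literature.NumberTheory.Automorphic.CuspidalAutomorphicRepData 2 ℚ hcpt, π.1.IsLAlgebraic ∧ ∀ᶠ v : IsDedekindDomain.HeightOneSpectrum (NumberField.RingOfIntegers ℚ) in cofinite, SatakeFrobCompatibleAt ι π.1 ρ v :=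
  fun hSA hcpt _ℓ _ ι ρ hirr hker hev => lAdicPlane_of_complexPlane hcpt hSA ι ρ hirr hker hev

end Summit.Langlands.Langlands.Theorems.HolomorphicShadow

end
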